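import Mathlib
import Literature.NumberTheory.Transcendental.GammaIsoCross
import Literature.NumberTheory.Transcendental.BKModelLimit
import Literature.NumberTheory.Transcendental.PseudoExpVariants
import Literature.NumberTheory.Transcendental.ZilberGenericClosedness
import Summits.Schanuel.Schanuel.Theorems.RigidCoreAclSubsetLogFreeCoreDoubleModelTransport
import Summits.Schanuel.Schanuel.Theorems.RigidCoreAclSubsetLogFreeCoreDoubleModelEmbedding
import Summits.Schanuel.Schanuel.Theorems.RigidCoreAclSubsetLogFreeCoreDoubleModelStrong

/-!
# Stub `stub_doubleModel` (line `eac-extends-core-automorphisms`, crux stmt-Schanuel-0968):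
the double of a free strong extension, model half

Step 4 of the doubling argument for the crux
`Summit.Schanuel.Schanuel.Theses.RigidCore.AclSubsetLogFreeCore` (Case I of the residue (A₀)).

Setting (produced by `stub_doubleBase` and `stub_doubleRank`): `X = ℚτ + ℚc ⊆ ℂ`, a tuple `e`,
`W = X + ℚe`, a subfield `F ⊆ ℂ` containing `W` and the division points `exp (x/M!)` (`x ∈ W`),
a finitely generated partial exponential field with standard kernel `(K, D, θ, t)`
(`IsStdKernelPartialExpField`), and two field embeddings `j₁ j₂ : F → K` with `jᵢ τ = t`,
agreeing on the generators of the Γ-field of `X`, with `D = span (j₁ W ∪ j₂ W)`, `θ ∘ jᵢ = jᵢ ∘ exp`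
on `W`, the first copy `S₁ = span (j₁ W)` strong inside `(K, D, θ)` (`hstrong`), the copies in
general position (`hnov`), and `rk(D ∪ θ D / S₁ ∪ θ S₁) ≤ ldim(D/S₁)` (`hrank`).

Conclusion (`stub_doubleModel`): an exponential field `M` with kernel `τ₁ℤ`, an isomorphism of
base Γ-fields `σ₀ : ℚ(ℚτ₁, exp) ≅ ℚ(ℚτ, exp)`, and tuples `c₁, e₁, e₂` in `M` with `(c₁, e₁)` and
`(c₁, e₂)` both cross-Γ-isomorphic to `(c, e)` over `σ₀`, `ℚτ₁ + ℚc₁ + ℚe₁ ◁ M`,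
`δ(e₂ / ℚτ₁ + ℚc₁ + ℚe₁) = 0`, and `Σ qⱼ (e₂ⱼ − e₁ⱼ) ∉ ℚτ₁ + ℚc₁` for `q ≠ 0`.

Proof: `M` is Bays–Kirby's countable model `BKModel.exists_countable_seac_model` over
`(K, D, θ, t)`, with its embedding `ιM : K →+* M` (`exp ∘ ιM = ιM ∘ θ` on `D`, kernel `ιM(t)ℤ`,
`span (ιM D) ◁ M`); `τ₁ = ιM t`, `c₁ = ιM j₁ c`, `e₁ = ιM j₁ e`, `e₂ = ιM j₂ e`.  The base
isomorphism and the two cross Γ-isomorphisms come from the embeddings `ιM ∘ jᵢ : F → M`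
(`exists_baseIso`, `isEBaseIso₂_of_base`, `isGammaIsoTw₂_of_embedding` of the support file
`…DoubleModelEmbedding`; `j₂ = j₁` on the base Γ-field by `hagree`); strongness of
`ιM(S₁) = ℚτ₁ + ℚ(c₁, e₁)` is `span (ιM D) ◁ M` plus `hstrong` transported along `ιM`
(`predim_map_nonneg_of_relRank`, `isStrong_of_forall_predim_nonneg_of_le` of `…DoubleModelStrong`,
Bays–Kirby 2018 Lemma 4.5); `δ(ιM D/ιM S₁) = 0` is `≥ 0` by the same and `≤ 0` by `hrank`
transported along `ιM` (`predim_map_map` of `…DoubleModelTransport`); general position is `hnov`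
pulled back along the injective `ℚ`-linear map `ιM`.

References: M. Bays, J. Kirby, *Pseudo-exponential maps, variants, and quasiminimality*, ANT 12
(2018), Def. 3.10, Lemma 4.5, §9.2, Thm 9.1.
-/

noncomputable section

-- `Summit.Schanuel.Schanuel.…` is the single-problem-summit namespace by design (D-0017).
set_option linter.dupNamespace false

open Set
open Literature.ModelTheory.ExponentialFields Literature.ModelTheory.ExponentialFields.ExponentialRing
open Literature.NumberTheory.Transcendental Literature.NumberTheory.Transcendental.GammaField

namespace Summit.Schanuel.Schanuel.Theorems.RigidCore

/-! ### Tuple and subspace bookkeeping -/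

/-- Composition with a concatenated tuple: `f ∘ (a, b) = (f ∘ a, f ∘ b)`. [folklore] -/
theorem comp_append_eq {α β : Type*} {m n : ℕ} (f : α → β) (a : Fin m → α) (b : Fin n → α) :
    (fun i => f (Fin.append a b i)) = Fin.append (fun i => f (a i)) (fun j => f (b j)) := by
  funext i
  refine Fin.addCases (fun i => ?_) (fun j => ?_) i
  · simp only [Fin.append_left]
  · simp only [Fin.append_right]

/-- A four-term lattice identity: `(P + C + E₁) + (P + C + E₂) = (P + C + E₁) + E₂`. [folklore] -/
theorem sup_sup_sup_eq_of_shared {L : Type*} [SemilatticeSup L] (P C E₁ E₂ : L) :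
    (P ⊔ (C ⊔ E₁)) ⊔ (P ⊔ (C ⊔ E₂)) = (P ⊔ (C ⊔ E₁)) ⊔ E₂ :=
  le_antisymm
    (sup_le le_sup_left (sup_le (le_sup_left.trans le_sup_left)
      (sup_le ((le_sup_left.trans le_sup_right).trans le_sup_left) le_sup_right)))
    (sup_le le_sup_left ((le_sup_right.trans le_sup_right).trans le_sup_right))

/-- The elements of a subfield `F ⊆ ℂ` lying in `ℚτ + ℚg ⊆ ℂ` (`τ`, `g` taken from `F`) form the
`ℚ`-subspace `ℚτ + ℚg` of `F`. [folklore] -/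
theorem setOf_coe_mem_eq_coe {F : IntermediateField ℚ ℂ} (τF : F) {n : ℕ} (gF : Fin n → F) :
    {x : F | (x : ℂ) ∈ Submodule.span ℚ ({(τF : ℂ)} : Set ℂ) ⊔
        Submodule.span ℚ (range fun i => (gF i : ℂ))} =
      ((Submodule.span ℚ ({τF} : Set F) ⊔ Submodule.span ℚ (range gF) : Submodule ℚ F) :
        Set F) := by
  ext x
  have h := apply_mem_map_iff (algebraMap F ℂ) (algebraMap F ℂ).toAddMonoidHom.toRatLinearMap
    (fun _ => rfl) (Λ := Submodule.span ℚ ({τF} : Set F) ⊔ Submodule.span ℚ (range gF)) (x := x)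
  rw [map_span_sup_span_eq] at h
  exact h

/-- Spans of images of a subspace under a field embedding: `span (j Ω) = j(Ω)`. [folklore] -/
theorem span_image_eq_map {F : IntermediateField ℚ ℂ} {K : Type*} [Field K] [CharZero K]
    (j : F →+* K) (Ω : Submodule ℚ F) :
    Submodule.span ℚ ((fun x : F => j x) '' (Ω : Set F)) =
      Ω.map j.toAddMonoidHom.toRatLinearMap := by
  rw [← coe_map_eq_image j j.toAddMonoidHom.toRatLinearMap (fun _ => rfl) Ω, Submodule.span_eq]

/-! ### The stub -/

/-- **Stub `stub_doubleModel` — the double, model half (Bays–Kirby's countable model over the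
double base).**  From the data of `stub_doubleBase` — together with the rank inequality `hrank` of
`stub_doubleRank` — there is an exponential field `M` (Bays–Kirby's `M(F_base)`:
`BKModel.exists_countable_seac_model` over `(K, D, θ, t)`, with embedding `ιM : K → M`,
`exp ∘ ιM = ιM ∘ θ` on `D`, kernel `ιM(t)ℤ`, `span (ιM D) ◁ M`) with kernel `τ₁ℤ`, an
isomorphism `σ₀ : ℚ^{ab}(τ₁) ≅ ℚ^{ab}(τ)` of base Γ-fields, and tuples `c₁ = ιM j₁ c`,
`e₁ = ιM j₁ e`, `e₂ = ιM j₂ e` such that both `(c₁, e₁)` and `(c₁, e₂)` are Γ-isomorphic over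
`σ₀` to `(c, e)` (`GammaField.isGammaIsoTw₂_of_ringHom` through `(ιM ∘ jᵢ)⁻¹`),
`ℚτ₁ + ℚc₁ + ℚe₁ ◁ M` (from `span (ιM D) ◁ M` and the internal strongness clause `hstrong`,
Bays–Kirby 2018 Lemma 4.5, and invariance of algebraic rank under `ιM`),
`δ(e₂ / ℚτ₁ + ℚc₁ + ℚe₁) = 0` (`≥ 0` likewise, `≤ 0` from `hrank` transported by `ιM`), and
the general-position clause `hnov` transported by `ιM`.  (The hypotheses `hX`, `hlin`, `hδ`,
`hjτ`-companions are part of the registered interface; `hX`, `hlin`, `hδ` enter only through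
`hrank`.) [cite: BaysKirby2018ANT, Thm 9.1, Lemma 4.5, Def. 3.10] -/
theorem stub_doubleModel (τ : ℂ) {N k : ℕ} (c : Fin N → ℂ) (e : Fin k → ℂ)
    (hX : IsStrong (Submodule.span ℚ ({τ} : Set ℂ) ⊔ Submodule.span ℚ (range c)))
    (hlin : LinIndepOver (Submodule.span ℚ ({τ} : Set ℂ) ⊔ Submodule.span ℚ (range c)) e)
    (hδ : predim (Submodule.span ℚ ({τ} : Set ℂ) ⊔ Submodule.span ℚ (range c))
      (Submodule.span ℚ (range e)) = 0)
    (F : IntermediateField ℚ ℂ)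
    (hFW : ∀ x ∈ Submodule.span ℚ ({τ} : Set ℂ) ⊔ Submodule.span ℚ (range (Fin.append c e)),
      x ∈ F ∧ ∀ M : ℕ, Complex.exp (x / (M.factorial : ℂ)) ∈ F)
    (K : Type) [Field K] [CharZero K] (D : Submodule ℚ K) (θ : K → K) (t : K) (j₁ j₂ : F →+* K)
    (hK : IsStdKernelPartialExpField K D θ t)
    (hjτ : ∀ hτF : τ ∈ F, j₁ ⟨τ, hτF⟩ = t ∧ j₂ ⟨τ, hτF⟩ = t)
    (hagree : ∀ (x : ℂ) (hxF : x ∈ F),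
      (x ∈ Submodule.span ℚ ({τ} : Set ℂ) ⊔ Submodule.span ℚ (range c) ∨
        ∃ y ∈ Submodule.span ℚ ({τ} : Set ℂ) ⊔ Submodule.span ℚ (range c), ∃ M : ℕ,
          x = Complex.exp (y / (M.factorial : ℂ))) →
      j₁ ⟨x, hxF⟩ = j₂ ⟨x, hxF⟩)
    (hD : D = Submodule.span ℚ
      ((fun x : F => j₁ x) '' {x : F | (x : ℂ) ∈ Submodule.span ℚ ({τ} : Set ℂ) ⊔
          Submodule.span ℚ (range (Fin.append c e))} ∪
        (fun x : F => j₂ x) '' {x : F | (x : ℂ) ∈ Submodule.span ℚ ({τ} : Set ℂ) ⊔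
          Submodule.span ℚ (range (Fin.append c e))}))
    (hθ : ∀ (x : ℂ) (hxF : x ∈ F) (hexF : Complex.exp x ∈ F),
      x ∈ Submodule.span ℚ ({τ} : Set ℂ) ⊔ Submodule.span ℚ (range (Fin.append c e)) →
      θ (j₁ ⟨x, hxF⟩) = j₁ ⟨Complex.exp x, hexF⟩ ∧ θ (j₂ ⟨x, hxF⟩) = j₂ ⟨Complex.exp x, hexF⟩)
    (hstrong : ∀ V : Submodule ℚ K,
      Submodule.span ℚ ((fun x : F => j₁ x) '' {x : F | (x : ℂ) ∈ Submodule.span ℚ ({τ} : Set ℂ) ⊔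
          Submodule.span ℚ (range (Fin.append c e))}) ≤ V → V ≤ D →
      ((ldim (Submodule.span ℚ ((fun x : F => j₁ x) '' {x : F | (x : ℂ) ∈ Submodule.span ℚ ({τ} : Set ℂ) ⊔
          Submodule.span ℚ (range (Fin.append c e))})) V : ℕ) : ℕ∞) ≤
        (algMatroid K).relRank
          (↑(Submodule.span ℚ ((fun x : F => j₁ x) '' {x : F | (x : ℂ) ∈ Submodule.span ℚ ({τ} : Set ℂ) ⊔
            Submodule.span ℚ (range (Fin.append c e))})) ∪
            θ '' ↑(Submodule.span ℚ ((fun x : F => j₁ x) '' {x : F | (x : ℂ) ∈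
              Submodule.span ℚ ({τ} : Set ℂ) ⊔ Submodule.span ℚ (range (Fin.append c e))})))
          (↑V ∪ θ '' ↑V))
    (hnov : ∀ (hcF : ∀ i, c i ∈ F) (heF : ∀ j, e j ∈ F) (q : Fin k → ℚ), q ≠ 0 →
      (∑ j, q j • (j₂ ⟨e j, heF j⟩ - j₁ ⟨e j, heF j⟩)) ∉
        Submodule.span ℚ ({t} : Set K) ⊔ Submodule.span ℚ (range fun i => j₁ ⟨c i, hcF i⟩))
    (hrank : (algMatroid K).relRank
        (↑(Submodule.span ℚ ((fun x : F => j₁ x) '' {x : F | (x : ℂ) ∈ Submodule.span ℚ ({τ} : Set ℂ) ⊔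
          Submodule.span ℚ (range (Fin.append c e))})) ∪
          θ '' ↑(Submodule.span ℚ ((fun x : F => j₁ x) '' {x : F | (x : ℂ) ∈
            Submodule.span ℚ ({τ} : Set ℂ) ⊔ Submodule.span ℚ (range (Fin.append c e))})))
        (↑D ∪ θ '' ↑D) ≤
      ((ldim (Submodule.span ℚ ((fun x : F => j₁ x) '' {x : F | (x : ℂ) ∈ Submodule.span ℚ ({τ} : Set ℂ) ⊔
          Submodule.span ℚ (range (Fin.append c e))})) D : ℕ) : ℕ∞)) :
    ∃ (M : Type) (_ : Field M) (_ : CharZero M) (_ : ExponentialRing M) (τ₁ : M)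
      (σ₀ : fieldOf (Submodule.span ℚ ({τ₁} : Set M)) ≃+*
        fieldOf (Submodule.span ℚ ({τ} : Set ℂ)))
      (c₁ : Fin N → M) (e₁ e₂ : Fin k → M),
      expKernel M = AddSubgroup.zmultiples τ₁ ∧ τ₁ ≠ 0 ∧
      IsEBaseIso₂ (Submodule.span ℚ ({τ₁} : Set M))
        (Submodule.span ℚ ({τ} : Set ℂ)) σ₀ ∧
      IsGammaIsoTw₂ σ₀ (Fin.append c₁ e₁) (Fin.append c e) ∧
      IsGammaIsoTw₂ σ₀ (Fin.append c₁ e₂) (Fin.append c e) ∧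
      IsStrong (Submodule.span ℚ ({τ₁} : Set M) ⊔ Submodule.span ℚ (range (Fin.append c₁ e₁))) ∧
      predim (Submodule.span ℚ ({τ₁} : Set M) ⊔ Submodule.span ℚ (range (Fin.append c₁ e₁)))
        (Submodule.span ℚ (range e₂)) = 0 ∧
      ∀ q : Fin k → ℚ, q ≠ 0 →
        (∑ j, q j • (e₂ j - e₁ j)) ∉ Submodule.span ℚ ({τ₁} : Set M) ⊔ Submodule.span ℚ (range c₁) := by
  classical
  /- Step 0: `τ`, `c`, `e` lie in `F`; rename them as elements of `F`. -/
  have hτF : τ ∈ F := (hFW τ (Submodule.mem_sup_left (Submodule.subset_span rfl))).1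
  have hgF : ∀ i, Fin.append c e i ∈ F := fun i =>
    (hFW _ (Submodule.mem_sup_right (Submodule.subset_span ⟨i, rfl⟩))).1
  have hcF : ∀ i, c i ∈ F := fun i => by
    simpa only [Fin.append_left] using hgF (Fin.castAdd k i)
  have heF : ∀ j, e j ∈ F := fun j => by
    simpa only [Fin.append_right] using hgF (Fin.natAdd N j)
  obtain ⟨τF, rfl⟩ : ∃ τF : F, (τF : ℂ) = τ := ⟨⟨τ, hτF⟩, rfl⟩
  obtain ⟨cF, rfl⟩ : ∃ cF : Fin N → F, (fun i => (cF i : ℂ)) = c := ⟨fun i => ⟨c i, hcF i⟩, rfl⟩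
  obtain ⟨eF, rfl⟩ : ∃ eF : Fin k → F, (fun j => (eF j : ℂ)) = e := ⟨fun j => ⟨e j, heF j⟩, rfl⟩
  /- Step 1: the subspace `Ω = ℚτ + ℚ(c, e)` of `F`; the hypotheses in terms of `Ω`. -/
  have hΩ : {x : F | (x : ℂ) ∈ Submodule.span ℚ ({(τF : ℂ)} : Set ℂ) ⊔ Submodule.span ℚ
      (range (Fin.append (fun i => (cF i : ℂ)) (fun j => (eF j : ℂ))))} =
      ((Submodule.span ℚ ({τF} : Set F) ⊔ Submodule.span ℚ (range (Fin.append cF eF)) :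
        Submodule ℚ F) : Set F) := by
    rw [← comp_append_eq Subtype.val cF eF]
    exact setOf_coe_mem_eq_coe τF (Fin.append cF eF)
  have hΩW : ∀ {x : F}, x ∈ Submodule.span ℚ ({τF} : Set F) ⊔
      Submodule.span ℚ (range (Fin.append cF eF)) →
      (x : ℂ) ∈ Submodule.span ℚ ({(τF : ℂ)} : Set ℂ) ⊔ Submodule.span ℚ
        (range (Fin.append (fun i => (cF i : ℂ)) (fun j => (eF j : ℂ)))) := fun {x} hx => by
    have h : x ∈ ((Submodule.span ℚ ({τF} : Set F) ⊔ Submodule.span ℚ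
      (range (Fin.append cF eF)) : Submodule ℚ F) : Set F) := hx
    rwa [← hΩ] at h
  rw [hΩ, Submodule.span_union, span_image_eq_map, span_image_eq_map] at hD
  rw [hΩ, span_image_eq_map] at hstrong hrank
  /- Step 2: Bays–Kirby's countable model over `(K, D, θ, t)`. -/
  obtain ⟨M, instF, instC, instE, ιM, -, -, -, hexpM, hker, hHM, -, -, -⟩ :=
    BKModel.exists_countable_seac_model hK
  /- Step 3: `exp` on `Ω` inside `F`; the embeddings `ιM ∘ jᵢ` intertwine it with `exp` of `M`. -/
  have hexW : ∀ x : F, (x : ℂ) ∈ Submodule.span ℚ ({(τF : ℂ)} : Set ℂ) ⊔ Submodule.span ℚ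
      (range (Fin.append (fun i => (cF i : ℂ)) (fun j => (eF j : ℂ)))) → Complex.exp x ∈ F :=
    fun x hx => by simpa using (hFW x hx).2 0
  obtain ⟨exF, hexF⟩ : ∃ exF : F → F, ∀ x : F, (x : ℂ) ∈ Submodule.span ℚ ({(τF : ℂ)} : Set ℂ) ⊔
      Submodule.span ℚ (range (Fin.append (fun i => (cF i : ℂ)) (fun j => (eF j : ℂ)))) →
      ((exF x : F) : ℂ) = Complex.exp x :=
    ⟨fun x => if h : (x : ℂ) ∈ Submodule.span ℚ ({(τF : ℂ)} : Set ℂ) ⊔ Submodule.span ℚ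
        (range (Fin.append (fun i => (cF i : ℂ)) (fun j => (eF j : ℂ)))) then
        ⟨Complex.exp x, hexW x h⟩ else 0,
      fun x hx => by simp only [dif_pos hx]⟩
  have hexΩ : ∀ x ∈ Submodule.span ℚ ({τF} : Set F) ⊔ Submodule.span ℚ (range (Fin.append cF eF)),
      ((exF x : F) : ℂ) = Complex.exp x := fun x hx => hexF x (hΩW hx)
  have hexB : ∀ x ∈ Submodule.span ℚ ({τF} : Set F), ((exF x : F) : ℂ) = Complex.exp x :=
    fun x hx => hexΩ x (Submodule.mem_sup_left hx)
  have hΩD₁ : ∀ x ∈ Submodule.span ℚ ({τF} : Set F) ⊔ Submodule.span ℚ (range (Fin.append cF eF)),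
      j₁ x ∈ D := fun x hx => by
    rw [hD]
    exact Submodule.mem_sup_left
      ((apply_mem_map_iff j₁ j₁.toAddMonoidHom.toRatLinearMap (fun _ => rfl)).2 hx)
  have hΩD₂ : ∀ x ∈ Submodule.span ℚ ({τF} : Set F) ⊔ Submodule.span ℚ (range (Fin.append cF eF)),
      j₂ x ∈ D := fun x hx => by
    rw [hD]
    exact Submodule.mem_sup_right
      ((apply_mem_map_iff j₂ j₂.toAddMonoidHom.toRatLinearMap (fun _ => rfl)).2 hx)
  have hφ₁ : ∀ x ∈ Submodule.span ℚ ({τF} : Set F) ⊔ Submodule.span ℚ (range (Fin.append cF eF)),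
      exp ((ιM.comp j₁) x) = (ιM.comp j₁) (exF x) := fun x hx => by
    rw [RingHom.comp_apply, RingHom.comp_apply, hexpM _ (hΩD₁ x hx)]
    congr 1
    have h := (hθ x x.2 (hexW x (hΩW hx)) (hΩW hx)).1
    rw [Subtype.coe_eta] at h
    rw [h]
    congr 1
    exact Subtype.ext (hexF x (hΩW hx)).symm
  have hφ₂ : ∀ x ∈ Submodule.span ℚ ({τF} : Set F) ⊔ Submodule.span ℚ (range (Fin.append cF eF)),
      exp ((ιM.comp j₂) x) = (ιM.comp j₂) (exF x) := fun x hx => by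
    rw [RingHom.comp_apply, RingHom.comp_apply, hexpM _ (hΩD₂ x hx)]
    congr 1
    have h := (hθ x x.2 (hexW x (hΩW hx)) (hΩW hx)).2
    rw [Subtype.coe_eta] at h
    rw [h]
    congr 1
    exact Subtype.ext (hexF x (hΩW hx)).symm
  have hφ₁B : ∀ x ∈ Submodule.span ℚ ({τF} : Set F),
      exp ((ιM.comp j₁) x) = (ιM.comp j₁) (exF x) := fun x hx => hφ₁ x (Submodule.mem_sup_left hx)
  have hBX : ∀ {x : F}, x ∈ Submodule.span ℚ ({τF} : Set F) →
      (x : ℂ) ∈ Submodule.span ℚ ({(τF : ℂ)} : Set ℂ) ⊔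
        Submodule.span ℚ (range fun i => (cF i : ℂ)) := fun {x} hx => by
    obtain ⟨q, rfl⟩ := Submodule.mem_span_singleton.1 hx
    exact Submodule.mem_sup_left (Submodule.smul_mem _ q (Submodule.subset_span (mem_singleton _)))
  have hj₁τ : j₁ τF = t := (hjτ τF.2).1
  have hj₂τ : j₂ τF = t := (hjτ τF.2).2
  have hτ₁ : (ιM.comp j₁) τF = ιM t := by rw [RingHom.comp_apply, hj₁τ]
  have hτ₂ : (ιM.comp j₂) τF = ιM t := by rw [RingHom.comp_apply, hj₂τ]
  /- Step 4: the base isomorphism `σ₀` and the two cross Γ-isomorphisms. -/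
  obtain ⟨σ₀, hσ₀⟩ := exists_baseIso (ιM.comp j₁) τF hexB hφ₁B hτ₁
  have hbase := isEBaseIso₂_of_base hexB hφ₁B hτ₁ σ₀ hσ₀
  have hΓ₁ := isGammaIsoTw₂_of_embedding (ιM.comp j₁) (Fin.append cF eF) hexΩ hφ₁ hτ₁ σ₀ hσ₀
  rw [comp_append_eq (ιM.comp j₁) cF eF, comp_append_eq Subtype.val cF eF] at hΓ₁
  -- the second copy: `j₂ = j₁` on the base Γ-field of `ℚτ` (`hagree`)
  have hj₂₁ : ∀ r ∈ Subfield.closure (((Submodule.span ℚ ({τF} : Set F) : Submodule ℚ F) : Set F) ∪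
      exF '' ((Submodule.span ℚ ({τF} : Set F) : Submodule ℚ F) : Set F)), j₂ r = j₁ r := by
    intro r hr
    refine (RingHom.eqOn_field_closure ?_ hr).symm
    rintro x (hx | ⟨y, hy, rfl⟩)
    · exact hagree x x.2 (Or.inl (hBX hx))
    · exact hagree _ (exF y).2 (Or.inr ⟨y, hBX hy, 0, by rw [hexB y hy]; simp⟩)
  have hσ₀' : ∀ r ∈ Subfield.closure (((Submodule.span ℚ ({τF} : Set F) : Submodule ℚ F) : Set F) ∪
      exF '' ((Submodule.span ℚ ({τF} : Set F) : Submodule ℚ F) : Set F)),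
      ∀ h h', σ₀ ⟨(ιM.comp j₂) r, h⟩ = ⟨(r : ℂ), h'⟩ := by
    intro r hr h h'
    have h₁ : (ιM.comp j₁) r ∈ fieldOf (Submodule.span ℚ ({ιM t} : Set M)) := by
      rw [RingHom.comp_apply, ← hj₂₁ r hr]; exact h
    rw [← hσ₀ r hr h₁ h']
    congr 1
    exact Subtype.ext (show (ιM.comp j₂) r = (ιM.comp j₁) r by
      rw [RingHom.comp_apply, RingHom.comp_apply, hj₂₁ r hr])
  have hΓ₂ := isGammaIsoTw₂_of_embedding (ιM.comp j₂) (Fin.append cF eF) hexΩ hφ₂ hτ₂ σ₀ hσ₀'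
  have hc₂₁ : (fun i => (ιM.comp j₂) (cF i)) = fun i => (ιM.comp j₁) (cF i) := by
    funext i
    have h := hagree _ (cF i).2 (Or.inl (Submodule.mem_sup_right (Submodule.subset_span ⟨i, rfl⟩)))
    rw [Subtype.coe_eta] at h
    rw [RingHom.comp_apply, RingHom.comp_apply, h]
  rw [comp_append_eq (ιM.comp j₂) cF eF, comp_append_eq Subtype.val cF eF, hc₂₁] at hΓ₂
  /- Step 5: `ιM(j₁ Ω) = ℚτ₁ + ℚ(c₁, e₁) ◁ M` and `δ(ιM D / ιM(j₁ Ω)) = 0`. -/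
  have hS₁D : (Submodule.span ℚ ({τF} : Set F) ⊔ Submodule.span ℚ (range (Fin.append cF eF))).map
      j₁.toAddMonoidHom.toRatLinearMap ≤ D := by
    rw [hD]; exact le_sup_left
  have hmapD : Submodule.span ℚ (ιM '' (D : Set K)) = D.map ιM.toAddMonoidHom.toRatLinearMap := by
    rw [← coe_map_eq_image ιM ιM.toAddMonoidHom.toRatLinearMap (fun _ => rfl) D, Submodule.span_eq]
  rw [hmapD] at hHM
  have hW₁ : ((Submodule.span ℚ ({τF} : Set F) ⊔ Submodule.span ℚ (range (Fin.append cF eF))).map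
      j₁.toAddMonoidHom.toRatLinearMap).map ιM.toAddMonoidHom.toRatLinearMap =
      Submodule.span ℚ ({ιM t} : Set M) ⊔ Submodule.span ℚ (range (Fin.append
        (fun i => (ιM.comp j₁) (cF i)) (fun j => (ιM.comp j₁) (eF j)))) := by
    rw [map_map_eq_map_comp, map_span_sup_span_eq, comp_append_eq, hτ₁]
  have hW₂ : ((Submodule.span ℚ ({τF} : Set F) ⊔ Submodule.span ℚ (range (Fin.append cF eF))).map
      j₂.toAddMonoidHom.toRatLinearMap).map ιM.toAddMonoidHom.toRatLinearMap =
      Submodule.span ℚ ({ιM t} : Set M) ⊔ Submodule.span ℚ (range (Fin.append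
        (fun i => (ιM.comp j₁) (cF i)) (fun j => (ιM.comp j₂) (eF j)))) := by
    rw [map_map_eq_map_comp, map_span_sup_span_eq, comp_append_eq, hτ₂, hc₂₁]
  have key : ∀ V' : Submodule ℚ M,
      ((Submodule.span ℚ ({τF} : Set F) ⊔ Submodule.span ℚ (range (Fin.append cF eF))).map
        j₁.toAddMonoidHom.toRatLinearMap).map ιM.toAddMonoidHom.toRatLinearMap ≤ V' →
      V' ≤ D.map ιM.toAddMonoidHom.toRatLinearMap →
      IsFG (((Submodule.span ℚ ({τF} : Set F) ⊔ Submodule.span ℚ (range (Fin.append cF eF))).map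
        j₁.toAddMonoidHom.toRatLinearMap).map ιM.toAddMonoidHom.toRatLinearMap) V' →
      0 ≤ predim (((Submodule.span ℚ ({τF} : Set F) ⊔ Submodule.span ℚ
        (range (Fin.append cF eF))).map j₁.toAddMonoidHom.toRatLinearMap).map
          ιM.toAddMonoidHom.toRatLinearMap) V' := fun V' h₁ h₂ h₃ =>
    predim_map_nonneg_of_relRank ιM ιM.toAddMonoidHom.toRatLinearMap (fun _ => rfl) θ hexpM hS₁D
      hstrong h₁ h₂ h₃
  have hstrong₁ : IsStrong (Submodule.span ℚ ({ιM t} : Set M) ⊔ Submodule.span ℚ (range (Fin.append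
      (fun i => (ιM.comp j₁) (cF i)) (fun j => (ιM.comp j₁) (eF j))))) := by
    rw [← hW₁]
    exact isStrong_of_forall_predim_nonneg_of_le hHM (Submodule.map_mono hS₁D) key
  have hDmap : D.map ιM.toAddMonoidHom.toRatLinearMap =
      (Submodule.span ℚ ({ιM t} : Set M) ⊔ Submodule.span ℚ (range (Fin.append
        (fun i => (ιM.comp j₁) (cF i)) (fun j => (ιM.comp j₁) (eF j))))) ⊔
        Submodule.span ℚ (range fun j => (ιM.comp j₂) (eF j)) := by
    rw [hD, Submodule.map_sup, hW₁, hW₂, ZilberHomogeneity.range_append,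
      ZilberHomogeneity.range_append, Submodule.span_union, Submodule.span_union]
    exact sup_sup_sup_eq_of_shared _ _ _ _
  have hfgD : IsFG (((Submodule.span ℚ ({τF} : Set F) ⊔ Submodule.span ℚ
      (range (Fin.append cF eF))).map j₁.toAddMonoidHom.toRatLinearMap).map
        ιM.toAddMonoidHom.toRatLinearMap) (D.map ιM.toAddMonoidHom.toRatLinearMap) :=
    isFG_of_fg ((Module.Finite.iff_fg.1 hK.finiteDimensional).map _) _
  have hδ₀ : predim (((Submodule.span ℚ ({τF} : Set F) ⊔ Submodule.span ℚ
      (range (Fin.append cF eF))).map j₁.toAddMonoidHom.toRatLinearMap).map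
        ιM.toAddMonoidHom.toRatLinearMap) (D.map ιM.toAddMonoidHom.toRatLinearMap) = 0 := by
    refine le_antisymm ?_ (key _ (Submodule.map_mono hS₁D) le_rfl hfgD)
    rw [predim_map_map ιM ιM.toAddMonoidHom.toRatLinearMap (fun _ => rfl) θ
      (fun x hx => hexpM x (hS₁D hx)) hexpM]
    have h1 := ENat.toNat_le_of_le_coe hrank
    omega
  /- Step 6: assembly. -/
  refine ⟨M, instF, instC, instE, ιM t, σ₀, fun i => (ιM.comp j₁) (cF i),
    fun j => (ιM.comp j₁) (eF j), fun j => (ιM.comp j₂) (eF j), hker,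
    (map_ne_zero ιM).2 hK.tau_ne_zero, hbase, hΓ₁, hΓ₂, hstrong₁, ?_, ?_⟩
  · -- `δ(e₂ / ℚτ₁ + ℚc₁ + ℚe₁) = 0`
    rw [← predim_sup_left, ← hDmap, ← hW₁]
    exact hδ₀
  · -- general position, pulled back along `ιM`
    intro q hq hmem
    refine hnov (fun i => (cF i).2) (fun j => (eF j).2) q hq ?_
    rw [← apply_mem_map_iff ιM ιM.toAddMonoidHom.toRatLinearMap (fun _ => rfl),
      map_span_sup_span_eq]
    have h : ιM (∑ j, q j • (j₂ (eF j) - j₁ (eF j))) =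
        ∑ j, q j • ((ιM.comp j₂) (eF j) - (ιM.comp j₁) (eF j)) := by
      simp only [map_sum, map_rat_smul, map_sub, RingHom.comp_apply]
    simp only [Subtype.coe_eta]
    rw [h]
    exact hmem

end Summit.Schanuel.Schanuel.Theorems.RigidCore
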